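import Mathlib.Analysis.SpecialFunctions.Pow.Deriv
import Mathlib.Analysis.SpecialFunctions.Pow.Asymptotics
import Mathlib.Analysis.SpecialFunctions.Complex.Arg
import Mathlib.Analysis.Calculus.Deriv.Polynomial
import Mathlib.RingTheory.MvPolynomial.Homogeneous
import Literature.NumberTheory.Transcendental.AnalytificationImplicit
import Summits.Schanuel.Schanuel.Theorems.ZilberEacComplexMovingPolydisc
import HarnessLib

/-!
# Quadric covers with imaginary leading root: analytic lemmas

Lemmas (independent of the oscillatory files) for `ZilberEacComplexQuadricCover.lean` (EC over `xₙ² = P(x')` when `P₂(2πi q)` is a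
negative real — the polynomial-decay regime of the first open rung of Exponential-Algebraic
Closedness, Mantova–Masser, PLMS 129 (2024), §1 p. 5):

* `sqrt_one_add_estimate` — the principal square root near `1`: `w = (1+u)^{1/2}` has `w² = 1+u`,
  `Re w > 0`, `‖w - 1 - u/2‖ ≤ ‖u‖²/2`, `‖w‖ ≤ 2` for `‖u‖ ≤ 1/2`;
* `quadricBranch_re_le` — the branch `σ iβm (1+u)^{1/2}`: square and real part;
* `eventually_sq_mul_log_add_le` — `(a log m + b)² ≤ ε m` eventually;
* `quadric_eval_sub_bound` — `‖P(m v + η) - m² P₂(v)‖ ≤ m (K₁ log m + K₂)` on logarithmic boxes.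

HONEST FRAMING: infrastructure for a modest new sub-rung of EAC; nothing here bears on Schanuel's
conjecture.
-/

noncomputable section

open Complex MvPolynomial Metric Set Filter Topology

set_option linter.dupNamespace false

namespace Summit.Schanuel.Schanuel.Theorems

/-! ### The principal square root near `1` -/

/-- **Principal square root near `1`.** For `‖u‖ ≤ 1/2` and `w = (1+u)^{1/2}` (principal branch):
`w² = 1 + u`, `0 < Re w`, `‖w - 1 - u/2‖ ≤ ‖u‖²/2` and `‖w‖ ≤ 2`. (Algebra: `w - 1 = u/(w+1)`,
`w - 1 - u/2 = -u²/(2(w+1)²)`, `|w + 1| ≥ 1 + Re w ≥ 1`.) [folklore] -/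
theorem sqrt_one_add_estimate {u : ℂ} (hu : ‖u‖ ≤ 1 / 2) :
    ((1 + u) ^ ((2 : ℂ)⁻¹)) ^ 2 = 1 + u ∧ 0 < ((1 + u) ^ ((2 : ℂ)⁻¹)).re ∧
      ‖(1 + u) ^ ((2 : ℂ)⁻¹) - 1 - u / 2‖ ≤ ‖u‖ ^ 2 / 2 ∧ ‖(1 + u) ^ ((2 : ℂ)⁻¹)‖ ≤ 2 := by
  have hsq : ((1 + u) ^ ((2 : ℂ)⁻¹)) ^ 2 = 1 + u := by
    have h := Complex.cpow_nat_inv_pow (1 + u) (n := 2) two_ne_zero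
    simp only [Nat.cast_ofNat] at h
    exact h
  have hre1 : 0 < (1 + u).re := by
    have h1 : |u.re| ≤ ‖u‖ := Complex.abs_re_le_norm u
    have h2 : -‖u‖ ≤ u.re := by have := neg_abs_le u.re; linarith
    rw [Complex.add_re, Complex.one_re]
    linarith
  have h1u : 1 + u ≠ 0 := fun h => by rw [h, Complex.zero_re] at hre1; exact lt_irrefl _ hre1
  set w : ℂ := (1 + u) ^ ((2 : ℂ)⁻¹) with hw
  have hwre : 0 < w.re := by
    rw [hw, Complex.cpow_def_of_ne_zero h1u, Complex.exp_re]
    refine mul_pos (Real.exp_pos _) (Real.cos_pos_of_mem_Ioo ?_)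
    have harg : |Complex.arg (1 + u)| < Real.pi / 2 :=
      Complex.abs_arg_lt_pi_div_two_iff.mpr (Or.inl hre1)
    have h2 : (2 : ℂ)⁻¹ = ((2⁻¹ : ℝ) : ℂ) := by push_cast; rfl
    have him : (Complex.log (1 + u) * (2 : ℂ)⁻¹).im = Complex.arg (1 + u) / 2 := by
      rw [h2, Complex.mul_im, Complex.ofReal_re, Complex.ofReal_im, mul_zero, zero_add,
        Complex.log_im]
      ring
    rw [him, Set.mem_Ioo]
    rw [abs_lt] at harg
    constructor <;> linarith [Real.pi_pos]
  have hw1re : 1 ≤ (w + 1).re := by rw [Complex.add_re, Complex.one_re]; linarith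
  have hw1norm : 1 ≤ ‖w + 1‖ := hw1re.trans (Complex.re_le_norm _)
  have hw1 : w + 1 ≠ 0 := fun h => by
    rw [h, norm_zero] at hw1norm; exact absurd hw1norm (by norm_num)
  have hE : w - 1 - u / 2 = -u ^ 2 / (2 * (w + 1) ^ 2) := by
    have hne : (2 * (w + 1) ^ 2 : ℂ) ≠ 0 := mul_ne_zero two_ne_zero (pow_ne_zero _ hw1)
    rw [eq_div_iff hne]
    linear_combination (2 * w + 2 - u) * hsq
  have hEn : ‖w - 1 - u / 2‖ ≤ ‖u‖ ^ 2 / 2 := by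
    rw [hE, norm_div, norm_neg, norm_pow, norm_mul, Complex.norm_two, norm_pow]
    refine div_le_div_of_nonneg_left (by positivity) (by norm_num) ?_
    nlinarith
  refine ⟨hsq, hwre, hEn, ?_⟩
  have h1 : ‖w‖ ≤ ‖w - 1 - u / 2‖ + ‖1 + u / 2‖ := by
    have := norm_add_le (w - 1 - u / 2) (1 + u / 2)
    rwa [show w - 1 - u / 2 + (1 + u / 2) = w by ring] at this
  have h3 : ‖1 + u / 2‖ ≤ 1 + ‖u‖ / 2 := by
    refine (norm_add_le _ _).trans ?_
    rw [norm_one, norm_div, Complex.norm_two]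
  nlinarith [norm_nonneg u]

/-- The branch `xₙ = σ·i·β·m·(1+u)^{1/2}` (`σ = ±1`): its square is `-β² m² (1 + u)` and its real
part is `-σ β m Im(u)/2` up to `β m ‖u‖²/2`. [folklore] -/
theorem quadricBranch_re_le {u : ℂ} (hu : ‖u‖ ≤ 1 / 2) {β m σ : ℝ} (hβ : 0 ≤ β) (hm : 0 ≤ m)
    (hσ : σ = 1 ∨ σ = -1) :
    ((σ : ℂ) * I * β * m * (1 + u) ^ ((2 : ℂ)⁻¹)) ^ 2 = -(((β : ℂ) ^ 2) * (m : ℂ) ^ 2 * (1 + u)) ∧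
    ((σ : ℂ) * I * β * m * (1 + u) ^ ((2 : ℂ)⁻¹)).re ≤ -σ * β * m * u.im / 2 + β * m * (‖u‖ ^ 2 / 2) ∧
    ‖(σ : ℂ) * I * β * m * (1 + u) ^ ((2 : ℂ)⁻¹)‖ ≤ 2 * β * m := by
  obtain ⟨hsq, -, hE, hw2⟩ := sqrt_one_add_estimate hu
  set w : ℂ := (1 + u) ^ ((2 : ℂ)⁻¹) with hw
  have hσ2 : (σ : ℂ) ^ 2 = 1 := by
    rcases hσ with h | h <;> simp [h]
  refine ⟨?_, ?_, ?_⟩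
  · calc ((σ : ℂ) * I * β * m * w) ^ 2 = (σ : ℂ) ^ 2 * I ^ 2 * (β : ℂ) ^ 2 * (m : ℂ) ^ 2 * w ^ 2 := by
          ring
      _ = _ := by rw [hσ2, Complex.I_sq, hsq]; ring
  · -- `w = 1 + u/2 + E`
    set E : ℂ := w - 1 - u / 2 with hEdef
    have hwE : w = 1 + u / 2 + E := by rw [hEdef]; ring
    have hmain : ((σ : ℂ) * I * β * m * w).re =
        -σ * β * m * u.im / 2 + (-(σ * β * m) * E.im) := by
      rw [hwE]
      simp only [Complex.mul_re, Complex.mul_im, Complex.add_re, Complex.add_im, Complex.I_re,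
        Complex.I_im, Complex.ofReal_re, Complex.ofReal_im, Complex.one_re, Complex.one_im,
        Complex.div_ofNat_re, Complex.div_ofNat_im]
      ring
    rw [hmain]
    have h1 : |E.im| ≤ ‖E‖ := Complex.abs_im_le_norm E
    have h2 : -(σ * β * m) * E.im ≤ β * m * ‖E‖ := by
      have hσ1 : |σ| = 1 := by rcases hσ with h | h <;> simp [h]
      have : |-(σ * β * m) * E.im| = β * m * |E.im| := by
        rw [abs_mul, abs_neg, abs_mul, abs_mul, hσ1, one_mul, abs_of_nonneg hβ, abs_of_nonneg hm]
      have h3 := le_abs_self (-(σ * β * m) * E.im)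
      rw [this] at h3
      exact h3.trans (mul_le_mul_of_nonneg_left h1 (by positivity))
    have h3 : β * m * ‖E‖ ≤ β * m * (‖u‖ ^ 2 / 2) := mul_le_mul_of_nonneg_left hE (by positivity)
    linarith
  · have hσ1 : ‖(σ : ℂ)‖ = 1 := by rcases hσ with h | h <;> simp [h]
    have hn : ‖(σ : ℂ) * I * β * m * w‖ = β * m * ‖w‖ := by
      rw [norm_mul, norm_mul, norm_mul, norm_mul, hσ1, Complex.norm_I, Complex.norm_real,
        Complex.norm_real, Real.norm_of_nonneg hβ, Real.norm_of_nonneg hm]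
      ring
    rw [hn]
    nlinarith [norm_nonneg w, mul_nonneg hβ hm]

/-! ### Auxiliary estimates -/

/-- `(a log m + b)² ≤ ε m` for all large `m` (`ε > 0`). [folklore] -/
theorem eventually_sq_mul_log_add_le (a b : ℝ) {ε : ℝ} (hε : 0 < ε) :
    ∀ᶠ m : ℕ in atTop, (a * Real.log m + b) ^ 2 ≤ ε * m := by
  have h1 : ∀ᶠ x : ℝ in atTop, ‖Real.log x ^ 2‖ ≤ ε / (4 * (a ^ 2 + 1)) * ‖x‖ :=
    (Real.isLittleO_pow_log_id_atTop (n := 2)).def (by positivity)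
  have h2 : ∀ᶠ m : ℕ in atTop, 2 * b ^ 2 ≤ ε / 2 * m :=
    (tendsto_natCast_atTop_atTop.const_mul_atTop (half_pos hε)).eventually_ge_atTop _
  filter_upwards [tendsto_natCast_atTop_atTop.eventually h1, h2, eventually_ge_atTop 1]
    with m hm hm2 hm1
  have hm0 : (0 : ℝ) ≤ m := by positivity
  rw [Real.norm_of_nonneg (sq_nonneg _), Real.norm_of_nonneg hm0] at hm
  have h3 : (a * Real.log m + b) ^ 2 ≤ 2 * (a ^ 2 * Real.log m ^ 2) + 2 * b ^ 2 := by
    nlinarith [sq_nonneg (a * Real.log m - b)]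
  have h4 : a ^ 2 * Real.log m ^ 2 ≤ a ^ 2 * (ε / (4 * (a ^ 2 + 1)) * m) :=
    mul_le_mul_of_nonneg_left hm (sq_nonneg a)
  have h5 : a ^ 2 * (ε / (4 * (a ^ 2 + 1)) * m) ≤ ε / 4 * m := by
    have : a ^ 2 / (a ^ 2 + 1) ≤ 1 := by
      rw [div_le_one (by positivity)]; linarith
    have h6 : a ^ 2 * (ε / (4 * (a ^ 2 + 1)) * m) = (a ^ 2 / (a ^ 2 + 1)) * (ε / 4 * m) := by
      field_simp
    rw [h6]
    exact (mul_le_mul_of_nonneg_right this (by positivity)).trans (by linarith)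
  linarith

/-- **Size of `P(m v + η) - m² P₂(v)` on logarithmic boxes** (`deg P = 2`): at most
`m (K₁ log m + K₂)` once `‖η‖ ≤ S log m + T`, for all large `m`. [folklore] -/
theorem quadric_eval_sub_bound {s : ℕ} (P : MvPolynomial (Fin s) ℂ) (hP2 : P.totalDegree = 2)
    (v : Fin s → ℂ) {S T : ℝ} (hS : 0 ≤ S) (hT : 0 ≤ T) :
    ∃ K₁ : ℝ, 0 ≤ K₁ ∧ ∃ K₂ : ℝ, 0 ≤ K₂ ∧ ∀ᶠ m : ℕ in atTop, ∀ η : Fin s → ℂ,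
      ‖η‖ ≤ S * Real.log m + T →
      ‖eval ((fun i => (m : ℂ) * v i) + η) P - (m : ℂ) ^ 2 * eval v (homogeneousComponent 2 P)‖ ≤
        m * (K₁ * Real.log m + K₂) := by
  classical
  set P2 := homogeneousComponent 2 P with hP2def
  set L : (Fin s → ℂ) →L[ℂ] ℂ :=
    ∑ i, eval v (pderiv i P2) • (ContinuousLinearMap.proj i : (Fin s → ℂ) →L[ℂ] ℂ) with hL
  have hfd : HasFDerivAt (fun w : Fin s → ℂ => eval w P2) L v :=
    Literature.NumberTheory.Transcendental.hasFDerivAt_eval _ v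
  obtain ⟨δ, hδ, hδ1⟩ : ∃ δ > 0, ∀ h : Fin s → ℂ, ‖h‖ < δ →
      ‖eval (v + h) P2 - eval v P2 - L h‖ ≤ 1 * ‖h‖ := by
    have h1 := (hasFDerivAt_iff_isLittleO_nhds_zero.mp hfd).def one_pos
    obtain ⟨δ, hδ, h2⟩ := Metric.eventually_nhds_iff.mp h1
    exact ⟨δ, hδ, fun h hh => h2 (by rwa [dist_zero_right])⟩
  have hB : ∀ k : ℕ, ∃ B : ℝ, 0 ≤ B ∧ ∀ h : Fin s → ℂ, ‖h‖ ≤ 1 →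
      ‖eval (v + h) (homogeneousComponent k P)‖ ≤ B := by
    intro k
    obtain ⟨C', hC', N', hCN⟩ :=
      Literature.NumberTheory.Transcendental.HypersurfaceCover.exists_norm_eval_le_pow
        (homogeneousComponent k P)
    refine ⟨C' * (2 + ‖v‖) ^ N', by positivity, fun h hh => (hCN (v + h)).trans ?_⟩
    have hle : 1 + ‖v + h‖ ≤ 2 + ‖v‖ := by have := norm_add_le v h; linarith
    exact mul_le_mul_of_nonneg_left (pow_le_pow_left₀ (by positivity) hle N') hC'
  obtain ⟨B₀, hB₀, hB₀le⟩ := hB 0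
  obtain ⟨B₁, hB₁, hB₁le⟩ := hB 1
  set δ₀ : ℝ := min δ 1 with hδ₀
  have hδ₀pos : 0 < δ₀ := lt_min hδ one_pos
  refine ⟨(‖L‖ + 1) * S, by positivity, B₀ + B₁ + (‖L‖ + 1) * T, by positivity, ?_⟩
  filter_upwards [eventually_mul_log_add_le S T (half_pos hδ₀pos), eventually_ge_atTop 1]
    with m hm hm_one η hη
  have hm1 : (1 : ℝ) ≤ m := by exact_mod_cast hm_one
  have hm0 : (0 : ℝ) < m := by linarith
  have hlog0 : 0 ≤ Real.log m := Real.log_nonneg hm1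
  set ζ : Fin s → ℂ := (m : ℂ)⁻¹ • η with hζ
  have hζnorm : ‖ζ‖ = (m : ℝ)⁻¹ * ‖η‖ := by
    rw [hζ, norm_smul, norm_inv, Complex.norm_natCast]
  have hζle : ‖ζ‖ ≤ δ₀ / 2 := by
    rw [hζnorm, inv_mul_le_iff₀ hm0]; linarith
  have hζδ : ‖ζ‖ < δ := by linarith [min_le_left δ 1]
  have hζ1 : ‖ζ‖ ≤ 1 := by linarith [min_le_right δ 1]
  have hdec : eval ((fun i => (m : ℂ) * v i) + η) P =
      ∑ k ∈ Finset.range (P.totalDegree + 1),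
        (m : ℂ) ^ k * eval (v + ζ) (homogeneousComponent k P) := by
    have hmC : (m : ℂ) ≠ 0 := by exact_mod_cast hm0.ne'
    have hx : (fun i => (m : ℂ) * v i) + η = (m : ℂ) • (v + ζ) := by
      funext i
      simp only [hζ, Pi.add_apply, Pi.smul_apply, smul_eq_mul]
      field_simp
    rw [hx]
    conv_lhs => rw [← sum_homogeneousComponent P]
    rw [map_sum]
    refine Finset.sum_congr rfl fun k _ => ?_
    exact (homogeneousComponent_isHomogeneous k P).eval_smul_eq _ _
  rw [hP2, show (2 : ℕ) + 1 = 0 + 1 + 1 + 1 from rfl, Finset.sum_range_succ, Finset.sum_range_succ,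
    Finset.sum_range_succ, Finset.sum_range_zero, zero_add] at hdec
  -- the three terms
  have hmnorm : ∀ (k : ℕ) (z : ℂ), ‖(m : ℂ) ^ k * z‖ = (m : ℝ) ^ k * ‖z‖ := by
    intro k z; rw [norm_mul, norm_pow, Complex.norm_natCast]
  have hT2 : ‖(m : ℂ) ^ (0 + 1 + 1) * eval (v + ζ) P2 - (m : ℂ) ^ 2 * eval v P2‖ ≤
      m * ((‖L‖ + 1) * ‖η‖) := by
    rw [show (0 + 1 + 1 : ℕ) = 2 from rfl, ← mul_sub, hmnorm]
    have h1 : ‖eval (v + ζ) P2 - eval v P2‖ ≤ (‖L‖ + 1) * ‖ζ‖ := by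
      have h2 := hδ1 ζ hζδ
      have h3 : ‖L ζ‖ ≤ ‖L‖ * ‖ζ‖ := L.le_opNorm ζ
      have h4 := norm_le_norm_add_norm_sub' (eval (v + ζ) P2 - eval v P2) (L ζ)
      have h5 : ‖eval (v + ζ) P2 - eval v P2 - L ζ‖ ≤ 1 * ‖ζ‖ := h2
      nlinarith [norm_nonneg ζ, norm_nonneg L]
    calc (m : ℝ) ^ 2 * ‖eval (v + ζ) P2 - eval v P2‖ ≤ (m : ℝ) ^ 2 * ((‖L‖ + 1) * ‖ζ‖) :=
          mul_le_mul_of_nonneg_left h1 (by positivity)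
      _ = m * ((‖L‖ + 1) * ‖η‖) := by rw [hζnorm]; field_simp
  have hT1 : ‖(m : ℂ) ^ (0 + 1) * eval (v + ζ) (homogeneousComponent (0 + 1) P)‖ ≤ m * B₁ := by
    rw [show (0 + 1 : ℕ) = 1 from rfl, hmnorm, pow_one]
    exact mul_le_mul_of_nonneg_left (hB₁le ζ hζ1) hm0.le
  have hT0 : ‖(m : ℂ) ^ 0 * eval (v + ζ) (homogeneousComponent 0 P)‖ ≤ m * B₀ := by
    rw [pow_zero, one_mul]
    exact (hB₀le ζ hζ1).trans (le_mul_of_one_le_left hB₀ hm1)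
  rw [hdec]
  have hsplit : (m : ℂ) ^ 0 * eval (v + ζ) (homogeneousComponent 0 P) +
      (m : ℂ) ^ (0 + 1) * eval (v + ζ) (homogeneousComponent (0 + 1) P) +
      (m : ℂ) ^ (0 + 1 + 1) * eval (v + ζ) (homogeneousComponent (0 + 1 + 1) P) -
      (m : ℂ) ^ 2 * eval v P2 =
      (m : ℂ) ^ 0 * eval (v + ζ) (homogeneousComponent 0 P) +
      (m : ℂ) ^ (0 + 1) * eval (v + ζ) (homogeneousComponent (0 + 1) P) +
      ((m : ℂ) ^ (0 + 1 + 1) * eval (v + ζ) P2 - (m : ℂ) ^ 2 * eval v P2) := by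
    rw [hP2def]; ring
  rw [hsplit]
  refine (norm_add_le _ _).trans ((add_le_add (norm_add_le _ _) le_rfl).trans ?_)
  have hηb : (‖L‖ + 1) * ‖η‖ ≤ (‖L‖ + 1) * (S * Real.log m + T) :=
    mul_le_mul_of_nonneg_left hη (by positivity)
  nlinarith [hT0, hT1, hT2, hηb, hm0]



end Summit.Schanuel.Schanuel.Theorems
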